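import Mathlib
import Summits.NavierStokesRegularity.NavierStokesRegularity.Theses.TaoLadderRungTwoFlat
import HarnessLib

/-!
# `TaoLadderRungTwoFlat.Assembly` — the route's assembly (item stmt-NavierStokesRegularity-22992; pure logic)

**Statement.** `FlatGapCertificatesV2 → GappedFrontRobustV2Flat → RestartControlOn → RestartGlue →
LocalDynamicsSufficesAtOn → Target`.

PROOF. The route file carries the planner-authored, kernel-checked deciding theorem
`Theses.TaoLadderRungTwoFlat.closes` with exactly these hypotheses; the assembly is its curried form.
An IMPLICATION only: the hypotheses (among them the two certificate cruxes) remain hypotheses.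

HONEST FRAMING: pure logic about a Tao-type MODEL lattice rung (M₂^{S♭}); nothing about Navier–Stokes.
-/

noncomputable section

set_option linter.dupNamespace false

namespace Summit.NavierStokesRegularity.NavierStokesRegularity.Theorems

open Summit.NavierStokesRegularity.NavierStokesRegularity.Theses.TaoLadderRungTwoFlat in
/-- **Item stmt-NavierStokesRegularity-22992** (`TaoLadderRungTwoFlat.Assembly`): the route's items imply
the rung `Target`, by the route file's deciding theorem `closes` (an implication; its hypotheses stay
hypotheses). [this file] -/
theorem taoLadderRungTwoFlat_assembly_proof :
    Summit.NavierStokesRegularity.NavierStokesRegularity.Theses.TaoLadderRungTwoFlat.Assembly := by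
  unfold Summit.NavierStokesRegularity.NavierStokesRegularity.Theses.TaoLadderRungTwoFlat.Assembly
  intro h₁ h₂ h₃ h₄ h₅
  exact closes h₁ h₂ h₃ h₄ h₅

end Summit.NavierStokesRegularity.NavierStokesRegularity.Theorems

end
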